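import Summits.SmoothPoincare4.SmoothPoincare4.Theorems.ConvexBisectionAcyclicBisectionExistsKasPageIso
import Summits.SmoothPoincare4.SmoothPoincare4.Theorems.ConvexBisectionAcyclicBisectionExistsPageRotationFlow
import Literature.Topology.FourManifolds.CircleMapsConjugateLoops
import Literature.AlgebraicTopology.SingularHomology.HurewiczProofs
import HarnessLib

/-!
# `H₁` of an arbitrary page of the Lefschetz base: comparison with the base, generators as loops
(wave 3, brick Z6-2 of the missing lemma `crossingNumber_eq_stdSymp` of node N1a
`node_M3c_shadow_pageDehnTwist` (Picard–Lefschetz on shadows) of stub `stub_modelsOnFibred_of_reach`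
= NF4, line `modp-braid-orbits`, crux `ConvexBisection.AcyclicBisectionExists`, item
stmt-SmoothPoincare4-10508; registered sub-goal `helper_bijective_map_pageIncl`)

The crossing number of a page loop factors through `H₁(page g c; ℤ)`
(`…CrossingNumberInvariance.lean`); the right-hand side `stdSymp (shadow a) (shadow K)` of the
missing lemma factors through the homology SHADOW, i.e. through `H₁(Base g; ℤ)`.  This file
identifies the two for EVERY unit direction `c` (the tree had the page of direction `1` only,
`stub_Kas_page_iso` / `bijective_map_pageIncl_one` of `…KasPageIso.lean`):

* §1 `exists_homeomorph_page` — a self-homeomorphism of `Base g` carrying `page g c` onto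
  `page g 1` (the time-one map of the rigid page rotation `helper_rotFlow_page` with constant
  profile `−arg c`; its inverse is the time-`(−1)` map); `pathConnectedSpace_page_of_norm`;
* §2 **`bijective_map_pageIncl`** / `helper_bijective_map_pageIncl` — the inclusion induces a
  bijection `H₁(page g c; ℤ) → H₁(Base g; ℤ)` for every `‖c‖ = 1` (conjugate the case `c = 1` by
  the homeomorphism); hence `injective_shadowMap_map_pageIncl`: the composite
  `shadowMap g ∘ incl_* : H₁(page g c; ℤ) → ℤ^{2g}` is a bijection (Milnor 1968, Thm. 9.1,
  `exists_isChainShadow_of`);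
* §3 `map_pageIncl_loopClass`, **`loopClass_page_eq_sum_of_shadow_eq`** — a linear relation
  `shadow K = Σ nᵢ • shadow Lᵢ` between shadows of page loops already holds between their Hurewicz
  classes in `H₁(page g c; ℤ)`;
* §4 **`exists_pageLoop_shadow_eq`** — every vector of `ℤ^{2g}` is the shadow of a loop of the page
  `page g c` (Hurewicz surjectivity `HurewiczProof.hurewiczOne_surjective` in the path-connected
  page, descent of based loops to circle maps `loopCircleMap`).

Everything is proved; no definitions, no named facts, no `sorry`.  References: J. Milnor, *Singular
points of complex hypersurfaces* (1968), Thm. 9.1 [Milnor1968]; A. Hatcher, *Algebraic Topology*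
(2002), Thm. 2A.1, Cor. 2.11 [HatcherAT2002].
-/

noncomputable section

set_option linter.dupNamespace false

open scoped Manifold ContDiff Topology Real
open Set Function Metric Filter
open Literature.Topology.FourManifolds Literature.Topology.FourManifolds.LefschetzBase
  Literature.AlgebraicTopology.SingularHomology

namespace Summit.SmoothPoincare4.SmoothPoincare4.Theorems.AcyclicBisectionExists.ModpBraidOrbits

variable {g : ℕ} {c : ℂ} {K : sphere (0 : EuclideanSpace ℝ (Fin 2)) 1 → Base g}

/-! ## §1 Rotating an arbitrary page onto the page of direction `1` -/

/-- `e^{−i arg c} · c = 1` for a unit complex number `c`. [folklore] -/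
theorem exp_neg_arg_mul_self (hc : ‖c‖ = 1) :
    Complex.exp (-(Complex.arg c * Complex.I)) * c = 1 := by
  have h := Complex.norm_mul_exp_arg_mul_I c
  rw [hc, Complex.ofReal_one, one_mul] at h
  calc Complex.exp (-(Complex.arg c * Complex.I)) * c
      = Complex.exp (-(Complex.arg c * Complex.I)) * Complex.exp (Complex.arg c * Complex.I) := by
        rw [h]
    _ = 1 := by rw [← Complex.exp_add, neg_add_cancel, Complex.exp_zero]

/-- **Every page is carried onto the page of direction `1` by a self-homeomorphism of the base**
(the time-one map of the rigid page rotation at angular speed `−arg c`, `helper_rotFlow_page`).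
[cite: Milnor1968, Thm. 9.1] -/
theorem exists_homeomorph_page (g : ℕ) (hc : ‖c‖ = 1) :
    ∃ F : Base g ≃ₜ Base g, ∀ x, x ∈ page g c ↔ F x ∈ page g 1 := by
  obtain ⟨R, θ, -, h0, hadd, hR, -, -, -, -, hpage⟩ :=
    helper_rotFlow_page g (fun _ => -Complex.arg c) contDiff_const
  have hp := hpage (-Complex.arg c) (fun _ => rfl)
  have hinv : ∀ t x, R.toFun (-t) (R.toFun t x) = x := fun t x =>
    Subtype.ext (by rw [hR, hR, hadd, neg_add_cancel, h0])
  have hcexp : Complex.exp (Complex.arg c * Complex.I) = c := by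
    have h := Complex.norm_mul_exp_arg_mul_I c
    rwa [hc, Complex.ofReal_one, one_mul] at h
  have e1 : Complex.exp (Complex.I * ((-Complex.arg c : ℝ) : ℂ) * ((1 : ℝ) : ℂ)) * c = 1 := by
    rw [← exp_neg_arg_mul_self hc]
    congr 2
    push_cast
    ring
  have e2 : Complex.exp (Complex.I * ((-Complex.arg c : ℝ) : ℂ) * ((-1 : ℝ) : ℂ)) * 1 = c := by
    rw [mul_one]
    calc Complex.exp (Complex.I * ((-Complex.arg c : ℝ) : ℂ) * ((-1 : ℝ) : ℂ))
        = Complex.exp (Complex.arg c * Complex.I) := by congr 1; push_cast; ring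
      _ = c := hcexp
  have hcont : ∀ t, Continuous (R.toFun t) := fun t => (R.contMDiff_toFun t).continuous
  let F : Base g ≃ₜ Base g :=
    { toFun := R.toFun 1
      invFun := R.toFun (-1)
      left_inv := hinv 1
      right_inv := fun x => by simpa using hinv (-1) x
      continuous_toFun := hcont 1
      continuous_invFun := hcont (-1) }
  refine ⟨F, fun x => ⟨fun hx => ?_, fun hx => ?_⟩⟩
  · have h := hp x c 1 hx
    rwa [e1] at h
  · have h := hp (R.toFun 1 x) 1 (-1) hx
    rwa [e2, hinv] at h

/-- **Every page of unit direction is homeomorphic to the page of direction `1`** compatibly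
with a self-homeomorphism of the base. [cite: Milnor1968, Thm. 9.1] -/
theorem exists_homeomorph_page_subtype (g : ℕ) (hc : ‖c‖ = 1) :
    ∃ (F : Base g ≃ₜ Base g) (Fs : ↥(page g c) ≃ₜ ↥(page g 1)), ∀ x, (Fs x).1 = F x.1 := by
  obtain ⟨F, hF⟩ := exists_homeomorph_page g hc
  exact ⟨F, F.subtype hF, fun _ => rfl⟩

/-- **Every page of unit direction is path connected** (the page of direction `1` is,
`pathConnectedSpace_page`). [cite: Milnor1968, §9 Lemma 9.2] -/
theorem pathConnectedSpace_page_of_norm (g : ℕ) (hc : ‖c‖ = 1) : PathConnectedSpace ↥(page g c) := by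
  obtain ⟨-, Fs, -⟩ := exists_homeomorph_page_subtype g hc
  haveI := pathConnectedSpace_page g
  exact Fs.symm.surjective.pathConnectedSpace Fs.symm.continuous

/-! ## §2 The inclusion of any page induces a bijection on `H₁` -/

/-- A homeomorphism induces a bijection on singular homology. [cite: HatcherAT2002, §2.1] -/
theorem bijective_map_homeomorph {X Y : Type} [TopologicalSpace X] [TopologicalSpace Y]
    (e : X ≃ₜ Y) (n : ℕ) :
    Function.Bijective (singularHomology.map ℤ ℤ (e : C(X, Y)) n) :=
  (CategoryTheory.ConcreteCategory.isIso_iff_bijective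
    (singularHomology.mapIso ℤ ℤ e n).hom).1 inferInstance

/-- Functoriality of singular homology, on elements. [cite: HatcherAT2002, §2.1] -/
theorem coe_map_comp {X Y Z : Type} [TopologicalSpace X] [TopologicalSpace Y]
    [TopologicalSpace Z] (f : C(X, Y)) (f' : C(Y, Z)) (n : ℕ) :
    ⇑(singularHomology.map ℤ ℤ (f'.comp f) n) =
      ⇑(singularHomology.map ℤ ℤ f' n) ∘ ⇑(singularHomology.map ℤ ℤ f n) := by
  rw [singularHomology.map_comp]
  funext x
  exact CategoryTheory.ConcreteCategory.comp_apply _ _ x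

/-- **`H₁(page g c; ℤ) → H₁(Base g; ℤ)`, induced by the inclusion, is bijective for every unit
direction `c`** (the case `c = 1` is `bijective_map_pageIncl_one`; conjugate by the page-rotating
homeomorphism). [cite: Milnor1968, Thm. 9.1] -/
theorem bijective_map_pageIncl (g : ℕ) (hc : ‖c‖ = 1) :
    Function.Bijective (singularHomology.map ℤ ℤ
      (⟨Subtype.val, continuous_subtype_val⟩ : C(↥(page g c), Base g)) 1) := by
  obtain ⟨F, Fs, hFs⟩ := exists_homeomorph_page_subtype g hc
  set ic : C(↥(page g c), Base g) := ⟨Subtype.val, continuous_subtype_val⟩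
  set i1 : C(↥(page g 1), Base g) := ⟨Subtype.val, continuous_subtype_val⟩
  have hcomm : i1.comp (Fs : C(↥(page g c), ↥(page g 1))) = (F : C(Base g, Base g)).comp ic :=
    ContinuousMap.ext hFs
  have h1 : Function.Bijective (singularHomology.map ℤ ℤ ((F : C(Base g, Base g)).comp ic) 1) := by
    rw [← hcomm, coe_map_comp]
    exact (bijective_map_pageIncl_one g).comp (bijective_map_homeomorph Fs 1)
  rw [coe_map_comp] at h1
  exact (Function.Bijective.of_comp_iff' (bijective_map_homeomorph F 1) _).1 h1

/-- **The chain shadow read on any page is a bijection `H₁(page g c; ℤ) ≅ ℤ^{2g}`.**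
[cite: Milnor1968, Thm. 9.1] -/
theorem bijective_shadowMap_map_pageIncl (g : ℕ) (hc : ‖c‖ = 1) :
    Function.Bijective (shadowMap g ∘ singularHomology.map ℤ ℤ
      (⟨Subtype.val, continuous_subtype_val⟩ : C(↥(page g c), Base g)) 1) :=
  (isChainShadow_shadowMap g (exists_isChainShadow_of g)).1.comp (bijective_map_pageIncl g hc)

/-! ## §3 Relations between shadows of page loops hold in `H₁` of the page -/

/-- The Hurewicz class in the base of a page loop is the push-forward of its class in the page.
[cite: HatcherAT2002, Thm. 2A.1] -/
theorem map_pageIncl_loopClass (hK : Continuous K) (hKc : ∀ θ, K θ ∈ page g c) :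
    singularHomology.map ℤ ℤ (⟨Subtype.val, continuous_subtype_val⟩ : C(↥(page g c), Base g)) 1
      (loopClass ℤ ℤ (1 : ℤ) (loopPath (fun θ => (⟨K θ, hKc θ⟩ : ↥(page g c))) (hK.subtype_mk hKc))) =
      loopClass ℤ ℤ (1 : ℤ) (loopPath K hK) := by
  rw [map_loopClass]
  exact loopClass_eq_of_ofPath_eq _ _ _ _ _ rfl

/-- The shadow of a page loop, read through its class in the page. [cite: Milnor1968, Thm. 9.1] -/
theorem shadow_eq_shadowMap_map_pageIncl (hK : Continuous K) (hKc : ∀ θ, K θ ∈ page g c) :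
    shadow g K hK = shadowMap g (singularHomology.map ℤ ℤ
      (⟨Subtype.val, continuous_subtype_val⟩ : C(↥(page g c), Base g)) 1
      (loopClass ℤ ℤ (1 : ℤ) (loopPath (fun θ => (⟨K θ, hKc θ⟩ : ↥(page g c))) (hK.subtype_mk hKc)))) := by
  rw [map_pageIncl_loopClass, shadow]

/-- **A linear relation between shadows of page loops holds between their Hurewicz classes in
`H₁(page g c; ℤ)`**: `shadow K = Σ nᵢ • shadow Lᵢ ⇒ h[K] = Σ nᵢ • h[Lᵢ]` in the page.
[cite: Milnor1968, Thm. 9.1] -/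
theorem loopClass_page_eq_sum_of_shadow_eq (hc : ‖c‖ = 1) (hK : Continuous K)
    (hKc : ∀ θ, K θ ∈ page g c) {ι : Type*} (s : Finset ι) (n : ι → ℤ)
    (L : ι → sphere (0 : EuclideanSpace ℝ (Fin 2)) 1 → Base g) (hL : ∀ i, Continuous (L i))
    (hLc : ∀ i θ, L i θ ∈ page g c)
    (h : shadow g K hK = ∑ i ∈ s, n i • shadow g (L i) (hL i)) :
    loopClass ℤ ℤ (1 : ℤ) (loopPath (fun θ => (⟨K θ, hKc θ⟩ : ↥(page g c))) (hK.subtype_mk hKc)) =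
      ∑ i ∈ s, n i • loopClass ℤ ℤ (1 : ℤ)
        (loopPath (fun θ => (⟨L i θ, hLc i θ⟩ : ↥(page g c))) ((hL i).subtype_mk (hLc i))) := by
  apply (bijective_shadowMap_map_pageIncl g hc).1
  simp only [Function.comp_apply, map_sum, map_zsmul]
  rw [← shadow_eq_shadowMap_map_pageIncl hK hKc, h]
  exact Finset.sum_congr rfl fun i _ => by rw [← shadow_eq_shadowMap_map_pageIncl (hL i) (hLc i)]

/-- **Page loops with equal shadows have equal Hurewicz classes in the page.**
[cite: Milnor1968, Thm. 9.1] -/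
theorem loopClass_page_eq_of_shadow_eq (hc : ‖c‖ = 1)
    {K₁ K₂ : sphere (0 : EuclideanSpace ℝ (Fin 2)) 1 → Base g} (hK₁ : Continuous K₁)
    (hK₁c : ∀ θ, K₁ θ ∈ page g c) (hK₂ : Continuous K₂) (hK₂c : ∀ θ, K₂ θ ∈ page g c)
    (h : shadow g K₁ hK₁ = shadow g K₂ hK₂) :
    loopClass ℤ ℤ (1 : ℤ) (loopPath (fun θ => (⟨K₁ θ, hK₁c θ⟩ : ↥(page g c))) (hK₁.subtype_mk hK₁c)) =
      loopClass ℤ ℤ (1 : ℤ) (loopPath (fun θ => (⟨K₂ θ, hK₂c θ⟩ : ↥(page g c))) (hK₂.subtype_mk hK₂c)) := by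
  have h' := loopClass_page_eq_sum_of_shadow_eq hc hK₁ hK₁c {(0 : ℕ)} (fun _ => 1) (fun _ => K₂)
    (fun _ => hK₂) (fun _ => hK₂c) (by rw [Finset.sum_singleton, one_zsmul, h])
  rwa [Finset.sum_singleton, one_zsmul] at h'

/-! ## §4 Every vector of `ℤ^{2g}` is the shadow of a page loop -/

/-- Every class of `H₁(page g c; ℤ)` is the Hurewicz class of the unit-period loop of a circle map
into the page (Hurewicz surjectivity in the path-connected page, descent of a based loop to the
circle). [cite: HatcherAT2002, Thm. 2A.1] -/
theorem exists_circleMap_loopClass_eq (hc : ‖c‖ = 1) (x : singularHomology ℤ ℤ ↥(page g c) 1) :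
    ∃ (K' : sphere (0 : EuclideanSpace ℝ (Fin 2)) 1 → ↥(page g c)) (hK' : Continuous K'),
      loopClass ℤ ℤ (1 : ℤ) (loopPath K' hK') = x := by
  haveI := pathConnectedSpace_page_of_norm g hc
  obtain ⟨q₀⟩ := (inferInstance : Nonempty ↥(page g c))
  obtain ⟨p, hp⟩ := HurewiczProof.hurewiczOne_surjective q₀ (Multiplicative.ofAdd x)
  induction p using Quotient.inductionOn with
  | h γ =>
    have hγ : loopClass ℤ ℤ (1 : ℤ) γ = x := by
      have h := hp
      rw [show (⟦γ⟧ : FundamentalGroup ↥(page g c) q₀) =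
        FundamentalGroup.fromPath (Path.Homotopic.Quotient.mk γ) from rfl, hurewiczOne_fromPath] at h
      exact Multiplicative.ofAdd.injective h
    let γc : C(unitInterval, ↥(page g c)) := ⟨γ, γ.continuous⟩
    have h01 : γc 0 = γc 1 := by
      show γ 0 = γ 1
      rw [γ.source, γ.target]
    refine ⟨loopCircleMap γc h01, (loopCircleMap γc h01).continuous, ?_⟩
    rw [← hγ]
    refine loopClass_eq_of_ofPath_eq _ _ _ _ _ ?_
    apply SingularSimplex.toContinuousMap_injective
    ext s : 1
    rw [SingularSimplex.ofPath_apply, SingularSimplex.ofPath_apply]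
    show loopCircleMap γc h01 (circleParam (stdSimplexHomeomorphUnitInterval s)) = γ _
    rw [loopCircleMap_circleParam]
    rfl

/-- **Every vector of `ℤ^{2g}` is the homology shadow of a loop of the page `page g c`.**
[cite: Milnor1968, Thm. 9.1] -/
theorem exists_pageLoop_shadow_eq (g : ℕ) (hc : ‖c‖ = 1) (v : Fin g ⊕ Fin g → ℤ) :
    ∃ (K : sphere (0 : EuclideanSpace ℝ (Fin 2)) 1 → Base g) (hK : Continuous K),
      (∀ θ, K θ ∈ page g c) ∧ shadow g K hK = v := by
  obtain ⟨x, hx⟩ := (bijective_shadowMap_map_pageIncl g hc).2 v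
  obtain ⟨K', hK', hK'x⟩ := exists_circleMap_loopClass_eq hc x
  refine ⟨fun θ => (K' θ).1, continuous_subtype_val.comp hK', fun θ => (K' θ).2, ?_⟩
  rw [shadow_eq_shadowMap_map_pageIncl _ (fun θ => (K' θ).2), ← hx, ← hK'x]
  rfl

/-! ## §5 The registered form -/

/-- **Sub-goal `helper_bijective_map_pageIncl`** (Z6-2 of the missing lemma of node N1a of NF4):
for every unit direction `c`, the inclusion of the page `page g c` into the base induces a
bijection `H₁(page g c; ℤ) → H₁(Base g; ℤ)` (Milnor 1968, Thm. 9.1: every page is a copy of the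
Milnor fibre and the base is fibre `×` disc). [cite: Milnor1968, Thm. 9.1] -/
theorem helper_bijective_map_pageIncl : ∀ (g : ℕ) (c : ℂ), ‖c‖ = 1 → Function.Bijective (Literature.AlgebraicTopology.SingularHomology.singularHomology.map ℤ ℤ (⟨Subtype.val, continuous_subtype_val⟩ : C(↥(Literature.Topology.FourManifolds.LefschetzBase.page g c), Literature.Topology.FourManifolds.LefschetzBase.Base g)) 1) :=
  fun g _ hc => bijective_map_pageIncl g hc

end Summit.SmoothPoincare4.SmoothPoincare4.Theorems.AcyclicBisectionExists.ModpBraidOrbits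

end
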